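import Summits.ResolutionOfSingularities.ResolutionOfSingularities.Theorems.WeightedInvariantE2CentreHomOfAss
import Literature.AlgebraicGeometry.Resolution.AlterationsSemiStableCodimTwo
import HarnessLib

/-!
# E2 centre, word (G-6b) `e2CentreHom`: the J-READING of the canonical e = 2 centre PROPAGATES from a read point of `maxLocus₂` to its
# generisations in the support (half (ii) of the remaining input «(a′)» of …E2CentreHomOfAss)

Route `ResolutionOfSingularities/WeightedInvariant`, crux `Theses.WeightedInvariant.HypersurfaceCentreConstruction`
(stmt-ResolutionOfSingularities-19897), door line `local-engine` (skeleton v3.12), E2 tier, registered stub `stub_e2_centre_h`, word (G-6b).  After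
…E2CentreHomOfAss the word rests on «(a′)»: the associated points `ξ` of `Γ(W) ⧸ Rₙ(W)` are maximal points of `closure (maxLocus₂)` (no embedded
points), of dimension `≤ 3`, at which `Rₙ` is READ BY `J` (`(Rₙ)_ξ = J(𝒪_ξ, f_ξ)ₙ`).  `IsCanonicalCentre₂.stalkIdeal_eq` gives the reading only at the
points of `maxLocus₂`; a generic point `ξ` of a component need not be one (`j = 0`: a curve of maximal closed points).  This file proves that the
reading PROPAGATES along generisation inside the support, by the LOCALISATION CLAUSE of (c9′-hom) (`CanonicalGameClauseHomLE`: at a singular position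
`(S, f)`, `J(S_𝔭, f)ₘ = J(S, f)ₘ·S_𝔭` for every prime `𝔭 ∋ f` above the centre prime `P`), the centre prime being below `𝔭` because
`Rₙ·S_𝔭 = 𝒥ₙ(u, w)·S_𝔭 ≠ ⊤` forces `uᵢ ∈ 𝔭` for every positive weight:
* `map_localization_eq_J_of_le_of_specializes` — MODEL FORM on an affine open `U ∋ η, ξ`, `ξ ⤳ η`, `X(U)·A_{𝔭(η)} = (F/1)`, `η ∈ singImage`,
  `dim 𝒪_η ≤ d`: if `I·A_{𝔭(η)} = J(A_{𝔭(η)}, F/1)ₙ` and `I ≤ 𝔭(ξ)` then `I·A_{𝔭(ξ)} = J(A_{𝔭(ξ)}, F/1)ₙ` ((c9′-hom)≤d + `JIsoInvariant`);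
* `Stage.stalkIdeal_piece_eq_J_of_specializes` — STALK FORM under the graded HOM rung: for a canonical e = 2 centre `R`, `η ∈ maxLocus₂`, `ξ ⤳ η` with
  `ξ ∈ supp Rₙ`: `(Rₙ)_ξ = J(𝒪_{Y,ξ}, f_ξ)ₙ`, and `dim 𝒪_{Y,ξ} ≤ 3`.
So the reading conjuncts of «(a′)» hold at every point of `supp Rₙ` generising a read point; what remains of (G-6b) is «(a″)»: `Rₙ(W)` has no
embedded associated primes and every generic point of a component of `closure (maxLocus₂)` generises a point of `maxLocus₂` (the second half is
automatic for an irreducible component of the closure).  Def-free helper (`--supports stmt-ResolutionOfSingularities-19897`); nothing here asserts any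
clause or anything about resolution of singularities in characteristic `p`; AI-written, weaker than expert review. [OURS · L1 W4.3]
-/

noncomputable section

set_option linter.dupNamespace false -- mandated namespace of this single-conjunct summit

open CategoryTheory AlgebraicGeometry TopologicalSpace IsLocalRing Topology
open Literature.AlgebraicGeometry.Resolution
open Summit.ResolutionOfSingularities.ResolutionOfSingularities.Theorems
open Summit.ResolutionOfSingularities.ResolutionOfSingularities.Theorems.ELadderOne

namespace Summit.ResolutionOfSingularities.ResolutionOfSingularities.Cruxes.HypersurfaceCentreConstruction.LocalEngine

/-! ## Model form -/

section Model

variable (ι : (R : Type) → [CommRing R] → R → Ordinal.{0}) (J : (R : Type) → [CommRing R] → R → ℕ → Ideal R)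
  {d p : ℕ} {k : Type} [Field k] [CharP k p] [PerfectField k] {Y : Scheme.{0}} (f : Y ⟶ Spec (.of k)) [Smooth f]
  (X : Y.IdealSheafData) (U : Y.affineOpens)

/-- Two ideals of `R` with the same extension along a ring isomorphism are equal. [folklore] -/
theorem eq_of_map_ringEquiv_eq {R T : Type*} [CommRing R] [CommRing T] (e : R ≃+* T) {I₁ I₂ : Ideal R}
    (h : I₁.map (e : R →+* T) = I₂.map (e : R →+* T)) : I₁ = I₂ := by
  rw [← Ideal.map_of_equiv (I := I₁) e, h, Ideal.map_of_equiv]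

include f in
/-- **MODEL FORM: the J-reading propagates to generisations.**  On an affine open `U` of the smooth `Y`, let `ξ ⤳ η` be points of `U` with
`dim 𝒪_{Y,η} ≤ d`, `η ∈ singImage X`, `X(U)·A_{𝔭(η)} = (F/1)`; if an ideal `I ≤ 𝔭(ξ)` of `Γ(Y, U)` is read by `J` at `η`
(`I·A_{𝔭(η)} = J(A_{𝔭(η)}, F/1)ₙ`), then it is read by `J` at `ξ` — by the localisation clause of (c9′-hom)≤d at the position `(A_{𝔭(η)}, F/1)`,
whose centre prime `P` lies below `𝔭(ξ)·A_{𝔭(η)}` since `J(A_{𝔭(η)}, F/1)ₙ = 𝒥ₙ(u, w) ∋ uᵢⁿ` for the positive weights. [folklore] -/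
theorem map_localization_eq_J_of_le_of_specializes (hgame : CanonicalGameClauseHomLE d p ι J) (hJ : JIsoInvariant J)
    {η ξ : Y} (hη : η ∈ (U : Y.Opens)) (hξ : ξ ∈ (U : Y.Opens)) (hξη : ξ ⤳ η)
    (hd : ringKrullDim (Y.presheaf.stalk η) ≤ d) (hηs : η ∈ singImage X) {F : Γ(Y, U)}
    (hFη : (X.ideal U).map (algebraMap Γ(Y, U) (Localization.AtPrime (U.2.primeIdealOf ⟨η, hη⟩).asIdeal)) =
      Ideal.span {algebraMap Γ(Y, U) (Localization.AtPrime (U.2.primeIdealOf ⟨η, hη⟩).asIdeal) F})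
    (I : Ideal Γ(Y, U)) (n : ℕ)
    (hIη : I.map (algebraMap Γ(Y, U) (Localization.AtPrime (U.2.primeIdealOf ⟨η, hη⟩).asIdeal)) =
      J (Localization.AtPrime (U.2.primeIdealOf ⟨η, hη⟩).asIdeal)
        (algebraMap Γ(Y, U) (Localization.AtPrime (U.2.primeIdealOf ⟨η, hη⟩).asIdeal) F) n)
    (hIξ : I ≤ (U.2.primeIdealOf ⟨ξ, hξ⟩).asIdeal) :
    I.map (algebraMap Γ(Y, U) (Localization.AtPrime (U.2.primeIdealOf ⟨ξ, hξ⟩).asIdeal)) =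
      J (Localization.AtPrime (U.2.primeIdealOf ⟨ξ, hξ⟩).asIdeal)
        (algebraMap Γ(Y, U) (Localization.AtPrime (U.2.primeIdealOf ⟨ξ, hξ⟩).asIdeal) F) n := by
  classical
  set 𝔮η := (U.2.primeIdealOf ⟨η, hη⟩).asIdeal with h𝔮η
  set 𝔮ξ := (U.2.primeIdealOf ⟨ξ, hξ⟩).asIdeal with h𝔮ξ
  haveI : 𝔮η.IsPrime := (U.2.primeIdealOf ⟨η, hη⟩).2
  haveI h𝔮ξp : 𝔮ξ.IsPrime := (U.2.primeIdealOf ⟨ξ, hξ⟩).2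
  have hle : 𝔮ξ ≤ 𝔮η := primeIdealOf_le_of_specializes U hη hξ hξη
  -- `Γ(Y, U)` of finite type over `k`; the model `Sη = A_{𝔭(η)}`: regular, essentially of finite type, dimension `≤ d`
  have hft : RingHom.FiniteType (f.appLE ⊤ U le_top).hom :=
    HasRingHomProperty.appLE @LocallyOfFiniteType f inferInstance ⟨⊤, isAffineOpen_top _⟩ U le_top
  let φ : k →+* Γ(Y, U) := (f.appLE ⊤ U le_top).hom.comp (Scheme.ΓSpecIso (.of k)).inv.hom
  have hφ : φ.FiniteType :=
    hft.comp (RingHom.FiniteType.of_surjective _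
      (Scheme.ΓSpecIso (.of k)).commRingCatIsoToRingEquiv.symm.surjective)
  letI : Algebra k Γ(Y, U) := φ.toAlgebra
  haveI : Algebra.FiniteType k Γ(Y, U) := hφ
  set Sη := Localization.AtPrime 𝔮η with hSη
  haveI : IsRegularLocalRing (Y.presheaf.stalk η) := isRegularLocalRing_stalk_of_smooth_of_field f η
  haveI hreg : IsRegularLocalRing Sη := IsRegularLocalRing.of_ringEquiv (stalkEquiv U hη).symm
  haveI : IsDomain Sη := isDomain_of_isRegularLocalRing _
  haveI : Algebra.EssFiniteType Γ(Y, U) Sη := Algebra.EssFiniteType.of_isLocalization Sη 𝔮η.primeCompl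
  haveI : Algebra.EssFiniteType k Sη := Algebra.EssFiniteType.comp k Γ(Y, U) Sη
  have hdS : ringKrullDim Sη ≤ d := by
    show ringKrullDim (Localization.AtPrime (U.2.primeIdealOf ⟨η, hη⟩).asIdeal) ≤ d
    rw [ringKrullDim_eq_of_ringEquiv (stalkEquiv U hη)]; exact hd
  -- the local equation `F/1`: non-zero and of order `≥ 2`
  have h0 : algebraMap Γ(Y, U) Sη F ≠ 0 := by
    intro h0
    apply ne_zero_of_mem_singImage_of_stalkIdeal_eq X (stalkIdeal_eq_span_germ_of_map_eq X U hη hFη) hηs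
    rwa [← algebraMap_eq_zero_iff_germ_eq_zero]
  have h2 : algebraMap Γ(Y, U) Sη F ∈ maximalIdeal Sη ^ 2 :=
    (mem_singImage_iff_algebraMap_mem_sq_of_map_eq X U hη hFη h0).mp hηs
  obtain ⟨P, hP, -, hfP, -, hloc, N, u, w, -, -, -, hPu, hJuw, -, -⟩ := hgame k Sη (algebraMap Γ(Y, U) Sη F) hdS h0 h2
  -- the prime `𝔭 = 𝔭(ξ)·Sη` of `Sη`, and `A_{𝔭(ξ)} ≃ (Sη)_𝔭`
  have hdisj : Disjoint (𝔮η.primeCompl : Set Γ(Y, U)) (𝔮ξ : Set Γ(Y, U)) := by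
    rw [Set.disjoint_left]
    intro a ha ha'
    exact ha (hle ha')
  set 𝔭 : Ideal Sη := 𝔮ξ.map (algebraMap Γ(Y, U) Sη) with h𝔭
  haveI h𝔭p : 𝔭.IsPrime := IsLocalization.isPrime_of_isPrime_disjoint 𝔮η.primeCompl Sη 𝔮ξ ‹_› hdisj
  have hunder : 𝔭.under Γ(Y, U) = 𝔮ξ := IsLocalization.under_map_of_isPrime_disjoint 𝔮η.primeCompl Sη ‹_› hdisj
  have hM : (𝔭.under Γ(Y, U)).primeCompl = 𝔮ξ.primeCompl := by
    ext a
    simp only [Ideal.mem_primeCompl_iff, hunder]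
  haveI : IsLocalization 𝔮ξ.primeCompl (Localization.AtPrime 𝔭) := by
    rw [← hM]
    exact IsLocalization.isLocalization_isLocalization_atPrime_isLocalization 𝔮η.primeCompl
      (Localization.AtPrime 𝔭) 𝔭
  let e : Localization.AtPrime 𝔮ξ ≃ₐ[Γ(Y, U)] Localization.AtPrime 𝔭 :=
    IsLocalization.algEquiv 𝔮ξ.primeCompl (Localization.AtPrime 𝔮ξ) (Localization.AtPrime 𝔭)
  let e' : Localization.AtPrime 𝔮ξ ≃+* Localization.AtPrime 𝔭 := e.toRingEquiv
  have he' : ∀ a : Γ(Y, U), e' (algebraMap Γ(Y, U) (Localization.AtPrime 𝔮ξ) a) =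
      algebraMap Sη (Localization.AtPrime 𝔭) (algebraMap Γ(Y, U) Sη a) := fun a => by
    show e _ = _
    rw [AlgEquiv.commutes, IsScalarTower.algebraMap_apply Γ(Y, U) Sη (Localization.AtPrime 𝔭)]
  -- (1) the centre prime lies below `𝔭`: `𝒥ₙ(u, w) = J(Sη, F/1)ₙ = I·Sη ≤ 𝔭`
  have hJle : J Sη (algebraMap Γ(Y, U) Sη F) n ≤ 𝔭 := by
    rw [← hIη]
    exact Ideal.map_mono hIξ
  have hP𝔭 : P ≤ 𝔭 := by
    rw [← hPu, Ideal.span_le]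
    rintro x ⟨i, hwi, rfl⟩
    have hmem : u i ^ n ∈ 𝔭 := hJle (hJuw n ▸ E2Model.pow_mem_weightedMonomialIdeal' u w i hwi n)
    exact h𝔭p.mem_of_pow_mem n hmem
  have hf𝔭 : algebraMap Γ(Y, U) Sη F ∈ 𝔭 := hP𝔭 hfP
  -- (2) the localisation clause of (c9′-hom)
  have hlocn := hloc 𝔭 hf𝔭 hP𝔭 n
  -- (3) transport along `e'`
  have key : (I.map (algebraMap Γ(Y, U) (Localization.AtPrime 𝔮ξ))).map (e' : _ →+* Localization.AtPrime 𝔭) =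
      (J (Localization.AtPrime 𝔮ξ) (algebraMap Γ(Y, U) (Localization.AtPrime 𝔮ξ) F) n).map
        (e' : _ →+* Localization.AtPrime 𝔭) := by
    have hcomp : (e' : Localization.AtPrime 𝔮ξ →+* Localization.AtPrime 𝔭).comp
        (algebraMap Γ(Y, U) (Localization.AtPrime 𝔮ξ)) =
        (algebraMap Sη (Localization.AtPrime 𝔭)).comp (algebraMap Γ(Y, U) Sη) := RingHom.ext he'
    rw [Ideal.map_map, hcomp, ← Ideal.map_map, hIη, ← hlocn, ← he' F]
    exact hJ _ _ e' (algebraMap Γ(Y, U) (Localization.AtPrime 𝔮ξ) F) n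
  exact eq_of_map_ringEquiv_eq e' key

end Model

end Summit.ResolutionOfSingularities.ResolutionOfSingularities.Cruxes.HypersurfaceCentreConstruction.LocalEngine

/-! ## Stalk form for the canonical e = 2 centre -/

namespace Summit.ResolutionOfSingularities.ResolutionOfSingularities.Theorems.ELadderOne.Stage

open Summit.ResolutionOfSingularities.ResolutionOfSingularities.Cruxes.HypersurfaceCentreConstruction.LocalEngine

variable {k : Type} [Field k] (S : Stage k) {p : ℕ} (ι : (R : Type) → [CommRing R] → R → Ordinal.{0})
  (J : (R : Type) → [CommRing R] → R → ℕ → Ideal R)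

/-- **The J-reading of the canonical e = 2 centre propagates to generisations inside the support.**  Under the graded HOM rung, for a canonical
e = 2 centre `R`, a read point `η ∈ maxLocus₂` and a generisation `ξ ⤳ η` with `ξ ∈ supp Rₙ`: `(Rₙ)_ξ = J(𝒪_{Y,ξ}, f_ξ)ₙ`. [folklore] -/
theorem stalkIdeal_piece_eq_J_of_specializes [CharP k p] [PerfectField k] (hr : PRungGrHomLE 3 p ι J)
    {R : ReesAlgebraData S.Y} (hR : S.IsCanonicalCentre₂ ι J R) {η ξ : S.Y} (hη : η ∈ S.maxLocus₂ ι) (hξη : ξ ⤳ η)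
    {n : ℕ} (hξn : ξ ∈ (R.piece n).support) :
    stalkIdeal (R.piece n) ξ = J (S.Y.presheaf.stalk ξ) (localGenerator S.i.ker ξ) n := by
  classical
  have hJ : JIsoInvariant J := hr.1.2.2.2.2.1
  have hgame : CanonicalGameClauseHomLE 3 p ι J := hr.1.2.2.2.2.2.2.1
  have hJu : JUnitInvariant J := hr.1.2.2.2.2.2.2.2.2.2
  -- a principal affine chart at `η`, hence at `ξ`
  obtain ⟨U, hηU, G, hG⟩ := S.isLocallyPrincipal η
  have hξU : ξ ∈ (U : S.Y.Opens) := hξη.mem_open U.1.isOpen hηU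
  have hGη : (S.i.ker.ideal U).map (algebraMap Γ(S.Y, U) (Localization.AtPrime (U.2.primeIdealOf ⟨η, hηU⟩).asIdeal)) =
      Ideal.span {algebraMap Γ(S.Y, U) (Localization.AtPrime (U.2.primeIdealOf ⟨η, hηU⟩).asIdeal) G} := by
    rw [hG, Ideal.map_span, Set.image_singleton]
  have hGξ : (S.i.ker.ideal U).map (algebraMap Γ(S.Y, U) (Localization.AtPrime (U.2.primeIdealOf ⟨ξ, hξU⟩).asIdeal)) =
      Ideal.span {algebraMap Γ(S.Y, U) (Localization.AtPrime (U.2.primeIdealOf ⟨ξ, hξU⟩).asIdeal) G} := by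
    rw [hG, Ideal.map_span, Set.image_singleton]
  -- the model reading at `η`
  have hIη := map_localization_eq_J_of_stalkIdeal_eq J S.i.ker U hηU S.f hJ hJu hGη (R.piece n) (hR.stalkIdeal_eq η hη n)
  -- `Rₙ(U) ≤ 𝔭(ξ)` since `ξ ∈ supp Rₙ`
  have hIξ : (R.piece n).ideal U ≤ (U.2.primeIdealOf ⟨ξ, hξU⟩).asIdeal := by
    intro a ha
    have hz := (Scheme.IdealSheafData.mem_support_iff_of_mem (I := R.piece n) (U := U) hξU).mp hξn
    have hξa : ξ ∉ S.Y.basicOpen a := (Scheme.mem_zeroLocus_iff S.Y _ ξ).mp hz a ha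
    by_contra hna
    exact hξa ((mem_basicOpen_iff_not_mem U hξU a).mpr hna)
  -- the model reading at `ξ`, then back to the stalk
  have hIξ' := map_localization_eq_J_of_le_of_specializes ι J S.f S.i.ker U hgame hJ hηU hξU hξη hη.1.2.2 hη.1.1 hGη
    ((R.piece n).ideal U) n hIη hIξ
  rw [stalkIdeal_eq_map_germ (R.piece n) U hξU, ← map_stalkEquiv_map U hξU, hIξ',
    J_localGenerator_eq_map_of_map_eq J S.i.ker U hξU S.f hJ hJu hGξ n]

/-- **… together with the dimension bound**: such a `ξ` has `dim 𝒪_{Y,ξ} ≤ 3` (a generisation of a read point). [folklore] -/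
theorem ringKrullDim_stalk_le_three_of_specializes_maxLocus₂ {η ξ : S.Y} (hη : η ∈ S.maxLocus₂ ι) (hξη : ξ ⤳ η) :
    ringKrullDim (S.Y.presheaf.stalk ξ) ≤ ((3 : ℕ) : WithBot ℕ∞) := by
  haveI : IsLocallyNoetherian S.Y := LocallyOfFiniteType.isLocallyNoetherian S.f
  by_cases hne : ξ = η
  · subst hne; exact hη.1.2.2
  · exact (ringKrullDim_stalk_lt_of_specializes hξη hne).le.trans hη.1.2.2

end Summit.ResolutionOfSingularities.ResolutionOfSingularities.Theorems.ELadderOne.Stage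

end
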